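import Summits.CriticalPhenomena.PercolationContinuityZ3.Theses.PercNonProliferation
import Summits.CriticalPhenomena.PercolationContinuityZ3.Theorems.PercNonProliferationNonProliferationRatioDichotomy
import HarnessLib

/-!
# Crux `PercNonProliferation.NonProliferation` (stmt-CriticalPhenomena-4444) — composition socket of
# line `jump-fragmentation` (INFINITE / FINITE / CONTINUOUS)

Lead c8 of line `jump-fragmentation` (crux-strategist skeleton `Cruxes/NonProliferation/Lines/jump_fragmentation.lean`).
Lands with `--supports stmt-CriticalPhenomena-4444`; closes nothing by itself (the three hypotheses are the
line's registered stubs, spelled out verbatim; no definitions).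

* **S1** `stub_infiniteClusterFewClasses` (load-bearing, OPEN): `∃ M c>0, ∃ᶠ n, P_{p_c}(no M+1 PERCOLATING
  points of B(n) pairwise unjoined inside B(2n)) ≥ c` — the critical infinite cluster, if any, meets `B(n)` in
  boundedly many `B(2n)`-connection classes with probability `≥ c`, infinitely often.
* **S2** `stub_jumpFiniteDebrisTight`: `0 < θ(p_c) → ∀ ε>0 ∃ M ∀ᶠ n, P_{p_c}(M+1 NON-percolating spanning
  representatives, pairwise unjoined) ≤ ε` (tightness of the finite spanning debris in a jump world;
  ⟸ `PercDebrisSweep.FiniteClusterVolumeTail`, stmt-CriticalPhenomena-0943).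
* **S3** `stub_contSureResidue` (parked behind stmt-CriticalPhenomena-5247): `θ(p_c) = 0 →` (sure crossing of
  the critical annulus at every ratio `k ≥ 2`) `→` the crux.

`nonProliferation_of_fewClasses_of_debris_of_residue : S1 → S2 → S3 → NonProliferation` (= the skeleton's
`NonProliferation_of`): cases on `θ(p_c) = 0`. Continuous case — if the crux failed, the landed ratio dichotomy
`crossing_tendsto_one_of_not_nonProliferation` (p124993) gives sure crossing at every ratio and S3 returns the
crux. Jump case — at a frequent scale of S1 where S2's debris event has probability `≤ c/2`, the pigeonhole
`pigeonhole_tuple`: `M₁+M₂+1` pairwise-unjoined spanning representatives contain `M₁+1` percolating ones or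
`M₂+1` non-percolating ones, so `A_n ⊆ {N_n ≤ M₁+M₂} ∪ D_n` and `P(N_n ≤ M₁+M₂) ≥ c/2` frequently.
-/

noncomputable section

namespace Summit.CriticalPhenomena.PercolationContinuityZ3.Theorems.NonProliferation

open MeasureTheory Filter Topology
open Literature.Probability.LatticeModels Literature.Probability.Percolation

namespace JumpFragmentation

/-! ### Pigeonhole: splitting a tuple of representatives by a predicate -/

/-- From a finite set `t` of indices of cardinality `K + 1`, all satisfying `P`, extract a `Fin (K+1)`-tuple of
pairwise distinct indices satisfying `P`. -/
theorem exists_tuple_of_card {N K : ℕ} (t : Finset (Fin N)) (ht : t.card = K + 1) (P : Fin N → Prop)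
    (hP : ∀ i ∈ t, P i) :
    ∃ f : Fin (K + 1) → Fin N, Function.Injective f ∧ ∀ a, P (f a) := by
  classical
  let e : Fin (K + 1) → t := fun a => t.equivFin.symm (Fin.cast ht.symm a)
  refine ⟨fun a => (e a).1, ?_, fun a => hP _ (e a).2⟩
  intro a b hab
  have h1 : e a = e b := Subtype.ext hab
  have h2 : Fin.cast ht.symm a = Fin.cast ht.symm b := t.equivFin.symm.injective h1
  exact Fin.cast_injective _ h2

/-- **Pigeonhole.** Given `M₁ + M₂ + 1` representatives `x i`, pairwise `bad`-related for distinct indices,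
either `M₁ + 1` of them satisfy `Q` or `M₂ + 1` of them satisfy `¬ Q` (as sub-tuples, still pairwise `bad`). -/
theorem pigeonhole_tuple {α : Type*} {M₁ M₂ : ℕ} (x : Fin (M₁ + M₂ + 1) → α) (Q : α → Prop)
    (bad : α → α → Prop) (hbad : ∀ i j, i ≠ j → bad (x i) (x j)) :
    (∃ y : Fin (M₁ + 1) → α, (∀ a, ∃ i, y a = x i) ∧ (∀ a, Q (y a)) ∧ ∀ a b, a ≠ b → bad (y a) (y b)) ∨
    (∃ y : Fin (M₂ + 1) → α, (∀ a, ∃ i, y a = x i) ∧ (∀ a, ¬ Q (y a)) ∧ ∀ a b, a ≠ b → bad (y a) (y b)) := by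
  classical
  set s : Finset (Fin (M₁ + M₂ + 1)) := Finset.univ.filter fun i => Q (x i) with hs
  set s' : Finset (Fin (M₁ + M₂ + 1)) := Finset.univ.filter fun i => ¬ Q (x i) with hs'
  have hcard : s.card + s'.card = M₁ + M₂ + 1 := by
    have h := Finset.card_filter_add_card_filter_not (s := (Finset.univ : Finset (Fin (M₁ + M₂ + 1))))
      (fun i => Q (x i))
    simpa [hs, hs'] using h
  by_cases h1 : M₁ + 1 ≤ s.card
  · left
    obtain ⟨t, hts, htc⟩ := Finset.exists_subset_card_eq h1
    obtain ⟨f, hf, hfP⟩ := exists_tuple_of_card t htc (fun i => Q (x i))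
      (fun i hi => (Finset.mem_filter.1 (hts hi)).2)
    exact ⟨fun a => x (f a), fun a => ⟨f a, rfl⟩, hfP, fun a b hab => hbad _ _ (fun h => hab (hf h))⟩
  · right
    have h2 : M₂ + 1 ≤ s'.card := by omega
    obtain ⟨t, hts, htc⟩ := Finset.exists_subset_card_eq h2
    obtain ⟨f, hf, hfP⟩ := exists_tuple_of_card t htc (fun i => ¬ Q (x i))
      (fun i hi => (Finset.mem_filter.1 (hts hi)).2)
    exact ⟨fun a => x (f a), fun a => ⟨f a, rfl⟩, hfP, fun a b hab => hbad _ _ (fun h => hab (hf h))⟩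

end JumpFragmentation

open JumpFragmentation

/-- **COMPOSITION of line `jump-fragmentation`: S1 → S2 → S3 → the crux** (the three registered stubs
`stub_infiniteClusterFewClasses`, `stub_jumpFiniteDebrisTight`, `stub_contSureResidue` spelled out verbatim
as the three hypotheses). Cases on `θ(p_c(ℤ³)) = 0`: continuous case by contradiction through the ratio
dichotomy `crossing_tendsto_one_of_not_nonProliferation` and S3; jump case by S1 at a frequent scale, S2
with `ε = c/2`, and `pigeonhole_tuple` (`M = M₁ + M₂`, probability `c/2`). -/
theorem nonProliferation_of_fewClasses_of_debris_of_residue :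
    (∃ (M : ℕ) (c : ℝ), 0 < c ∧ ∃ᶠ n : ℕ in atTop, c ≤ (bondPercolation (zdGraph 3) (criticalProbI 3)).real
      {ω | ¬ ∃ x : Fin (M + 1) → Site 3, (∀ i, x i ∈ box 3 n) ∧ (∀ i, ω ∈ percolatesAt (x i)) ∧
        ∀ i j, i ≠ j → ω ∉ openConnIn (↑(box 3 (2 * n)) : Set (Site 3)) (x i) (x j)}) →
    (0 < theta (zdGraph 3) (0 : Site 3) (criticalProbI 3) →
      ∀ ε : ℝ, 0 < ε → ∃ M : ℕ, ∀ᶠ n : ℕ in atTop, (bondPercolation (zdGraph 3) (criticalProbI 3)).real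
        {ω | ∃ x : Fin (M + 1) → Site 3, (∀ i, x i ∈ box 3 n) ∧ (∀ i, ω ∉ percolatesAt (x i)) ∧
          (∀ i, ∃ y ∈ innerBoundary (zdGraph 3) (box 3 (2 * n)),
            ω ∈ openConnIn (↑(box 3 (2 * n)) : Set (Site 3)) (x i) y) ∧
          ∀ i j, i ≠ j → ω ∉ openConnIn (↑(box 3 (2 * n)) : Set (Site 3)) (x i) (x j)} ≤ ε) →
    (theta (zdGraph 3) (0 : Site 3) (criticalProbI 3) = 0 →
      (∀ k : ℕ, 2 ≤ k → Tendsto (fun m : ℕ => (bondPercolation (zdGraph 3) (criticalProbI 3)).real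
        {ω | ∃ x ∈ box 3 m, ∃ y ∈ innerBoundary (zdGraph 3) (box 3 (k * m)),
          ω ∈ openConnIn (↑(box 3 (k * m)) : Set (Site 3)) x y}) atTop (𝓝 1)) →
      ∃ (M : ℕ) (c : ℝ), 0 < c ∧ ∃ᶠ n : ℕ in atTop, c ≤ (bondPercolation (zdGraph 3) (criticalProbI 3)).real
        {ω | ¬ ∃ x : Fin (M + 1) → Site 3, (∀ i, x i ∈ box 3 n) ∧
          (∀ i, ∃ y ∈ innerBoundary (zdGraph 3) (box 3 (2 * n)),
            ω ∈ openConnIn (↑(box 3 (2 * n)) : Set (Site 3)) (x i) y) ∧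
          ∀ i j, i ≠ j → ω ∉ openConnIn (↑(box 3 (2 * n)) : Set (Site 3)) (x i) (x j)}) →
    Summit.CriticalPhenomena.PercolationContinuityZ3.Theses.PercNonProliferation.NonProliferation := by
  intro hS1 hS2 hS3
  have theta_nonneg : 0 ≤ theta (zdGraph 3) (0 : Site 3) (criticalProbI 3) := by
    unfold theta
    exact measureReal_nonneg
  by_cases h0 : theta (zdGraph 3) (0 : Site 3) (criticalProbI 3) = 0
  · -- continuous world: either the crux holds, or sure crossing at every ratio and S3 gives it
    by_contra hNP
    exact hNP (hS3 h0 (fun k hk => crossing_tendsto_one_of_not_nonProliferation hNP hk))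
  · -- jump world: S1 at a frequent scale, S2 w.h.p., pigeonhole
    have hpos : 0 < theta (zdGraph 3) (0 : Site 3) (criticalProbI 3) :=
      lt_of_le_of_ne theta_nonneg (Ne.symm h0)
    obtain ⟨M₁, c, hc, hfreq⟩ := hS1
    obtain ⟨M₂, hev⟩ := hS2 hpos (c / 2) (by linarith)
    set μ : Measure (BondConfig (Site 3)) := bondPercolation (zdGraph 3) (criticalProbI 3) with hμ
    unfold Summit.CriticalPhenomena.PercolationContinuityZ3.Theses.PercNonProliferation.NonProliferation
    refine ⟨M₁ + M₂, c / 2, by linarith, ?_⟩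
    refine (hfreq.and_eventually hev).mono ?_
    rintro n ⟨hA, hD⟩
    -- names for the three events at scale `n`
    set A : Set (BondConfig (Site 3)) := {ω | ¬ ∃ x : Fin (M₁ + 1) → Site 3, (∀ i, x i ∈ box 3 n) ∧
        (∀ i, ω ∈ percolatesAt (x i)) ∧
        ∀ i j, i ≠ j → ω ∉ openConnIn (↑(box 3 (2 * n)) : Set (Site 3)) (x i) (x j)} with hAdef
    set D : Set (BondConfig (Site 3)) := {ω | ∃ x : Fin (M₂ + 1) → Site 3, (∀ i, x i ∈ box 3 n) ∧
        (∀ i, ω ∉ percolatesAt (x i)) ∧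
        (∀ i, ∃ y ∈ innerBoundary (zdGraph 3) (box 3 (2 * n)),
          ω ∈ openConnIn (↑(box 3 (2 * n)) : Set (Site 3)) (x i) y) ∧
        ∀ i j, i ≠ j → ω ∉ openConnIn (↑(box 3 (2 * n)) : Set (Site 3)) (x i) (x j)} with hDdef
    set G : Set (BondConfig (Site 3)) := {ω | ¬ ∃ x : Fin (M₁ + M₂ + 1) → Site 3, (∀ i, x i ∈ box 3 n) ∧
        (∀ i, ∃ y ∈ innerBoundary (zdGraph 3) (box 3 (2 * n)),
          ω ∈ openConnIn (↑(box 3 (2 * n)) : Set (Site 3)) (x i) y) ∧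
        ∀ i j, i ≠ j → ω ∉ openConnIn (↑(box 3 (2 * n)) : Set (Site 3)) (x i) (x j)} with hGdef
    -- pigeonhole: `A ⊆ G ∪ D`
    have hsub : A ⊆ G ∪ D := by
      intro ω hωA
      by_cases hωG : ω ∈ G
      · exact Or.inl hωG
      right
      simp only [hGdef, Set.mem_setOf_eq, not_not] at hωG
      obtain ⟨x, hxbox, hxbd, hxbad⟩ := hωG
      rcases pigeonhole_tuple (M₁ := M₁) (M₂ := M₂) x (fun z => ω ∈ percolatesAt z)
          (fun z w => ω ∉ openConnIn (↑(box 3 (2 * n)) : Set (Site 3)) z w) hxbad with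
        ⟨y, hy, hyQ, hybad⟩ | ⟨y, hy, hyQ, hybad⟩
      · exfalso
        refine hωA ⟨y, fun a => ?_, hyQ, hybad⟩
        obtain ⟨i, hi⟩ := hy a
        rw [hi]; exact hxbox i
      · refine ⟨y, fun a => ?_, hyQ, fun a => ?_, hybad⟩
        · obtain ⟨i, hi⟩ := hy a
          rw [hi]; exact hxbox i
        · obtain ⟨i, hi⟩ := hy a
          rw [hi]; exact hxbd i
    have hle : μ.real A ≤ μ.real G + μ.real D :=
      (measureReal_mono hsub).trans (measureReal_union_le G D)
    change c / 2 ≤ μ.real G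
    linarith

end Summit.CriticalPhenomena.PercolationContinuityZ3.Theorems.NonProliferation

end
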